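import Summits.PneNP.PneNP.Theorems.GapMCSPWindowCellZeroProduct

/-!
# Gap-MCSP window cell `q = 0` (trade-off law) — VIII. The count `t + 2·nocc ≤ 2G + 3`

Part of the tree landing of HOME/decomp-pnenp-lens-1/TradeOffLaw.lean (sha256 880b490f…, lens-1 g13 of the decomp-pnenp root-decomposition cell; critic NODE-VERDICT 2026-08-30T13:09:32Z CLEARED, landing endorsed (6)(a)):
a SIZE–ACCEPTANCE TRADE-OFF for every `B₂`-circuit on `N` inputs that accepts `0^N` and every point
indicator `e_p` — `N ≤ 9·L·(L + G + 3 − N)`, `L = ⌊log₂ acc⌋`, `G` = number of gates — and its payout: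
the Oliveira–Pich–Santhanam gap problem `Gap-MCSP[2^{βn}/(cn), 2^{βn}]` (census R3) is not separated by
`B₂`-circuit families of eventually `≤ N` gates (`0 < β < 1/3`, every `c ≥ 1`), i.e. the `q = 0` cell of
the window dial of route `route-PneNP-RootDecompMagnificationPayout` (item stmt-PneNP-33309 `WindowCellZero`,
BC5 rung for the attacked item stmt-PneNP-32096). Modules, in dependency order: `…Formulas` (rooted
`B₂`-formulas and additive valuations) → `…Counting` (uniform counting, silent/flipping variables, numeric
helpers) → `…FlipLaw` (the exact acceptance law for read-once formulas) → `…Unfolding` (rooted unfolding of a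
gate list, consistency, references) → `…Potential` (variables/nodes of unfoldings, the root potential: no
duplication across root formulas) → `…Relevance` (relevant roots, link, locality) → `…Product` (boxes, the two
exponent bounds, pigeonhole, the final arithmetic) → `…Count` (`t + 2·nocc ≤ 2G + 3`) → `GapMCSPWindowCellZero`
(the law proved, the payout in tree vocabulary). Proof-internal machinery: nothing here bears on P vs NP
beyond the S-free lower bound it proves; all statements are [folklore]-tagged kernel lemmas of the lens.

THIS FILE (lens §7): relevant gate roots `Ridx` / input roots `Iidx`, `|Rel| = |Iidx| + |Ridx|`; `Rel` is the
output plus references of relevant gate roots; occurrences ≤ relevant gate nodes + 1; every relevant root other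
than the output is READ (input roots `≥ 2` times, gate roots `≥ 2` times, root-formula variables `≥ 1` time,
expanded gate nodes `≥ 1` time) by distinct argument slots (`≤ 2G`, `sum_arity_eq`); THE COUNT
`|Rel| + 2·nocc ≤ 2G + 3` and `nocc ≤ N`.
-/

noncomputable section

set_option linter.dupNamespace false -- `Summit.PneNP.PneNP.…`: summit = sub-problem name (D-0017 single-conjunct layout)

namespace Summit.PneNP.PneNP.Theorems.GapMCSPWindowCellZero

open Literature.Computability.Complexity

/-! ## §7 THE COUNT: few relevant roots, few occurrences (`t + 2·nocc ≤ 2G + 3`, `nocc ≤ N`)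

Every relevant root other than the output is READ: a relevant input root `≥ 2` times, a relevant
gate root `≥ 2` times, every variable of a root formula `≥ 1` time, every expanded (non-root) gate
node `≥ 1` time — all by distinct argument slots, of which there are `≤ 2G`. Together with the
tree shape of each root formula (`#literal leaves + #reference leaves ≤ #gate nodes + 1`) and the
generation of `Rel` by references this gives `t + 2·nocc ≤ 2G + 3`. -/

section Count

open Finset
open Literature.Computability.Complexity.GateList

variable {N : ℕ}

namespace BF

section Fixed

variable {gs : List (Gate (Fin N))} {m₀ : ℕ}

/-- Relevant gate roots and relevant input roots. -/
def Ridx (gs : List (Gate (Fin N))) (m₀ : ℕ) : Finset ℕ :=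
  (range gs.length).filter fun m => (Sum.inr m : Fin N ⊕ ℕ) ∈ Rel gs m₀

/-- Relevant input roots. -/
def Iidx (gs : List (Gate (Fin N))) (m₀ : ℕ) : Finset (Fin N) :=
  univ.filter fun i => (Sum.inl i : Fin N ⊕ ℕ) ∈ Rel gs m₀

/-- Membership in `Ridx`, unfolded. -/
theorem mem_Ridx {m : ℕ} : m ∈ Ridx gs m₀ ↔ (Sum.inr m : Fin N ⊕ ℕ) ∈ Rel gs m₀ := by
  simp only [Ridx, mem_filter, mem_range, and_iff_right_iff_imp]
  exact fun h => lt_of_inr_mem_Rel h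

/-- Membership in `Iidx`, unfolded. -/
theorem mem_Iidx {i : Fin N} : i ∈ Iidx gs m₀ ↔ (Sum.inl i : Fin N ⊕ ℕ) ∈ Rel gs m₀ := by
  simp [Iidx]

/-- `Rel` splits into relevant input roots and relevant gate roots. -/
theorem Rel_eq : Rel gs m₀ = (Iidx gs m₀).map ⟨Sum.inl, Sum.inl_injective⟩ ∪
    (Ridx gs m₀).map ⟨Sum.inr, Sum.inr_injective⟩ := by
  ext w
  cases w with
  | inl i => simp [mem_Iidx]
  | inr m => simp [mem_Ridx]

/-- Input roots and gate roots are disjoint as wires. -/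
theorem disjoint_IR : Disjoint ((Iidx gs m₀).map ⟨Sum.inl, Sum.inl_injective⟩)
    ((Ridx gs m₀).map ⟨Sum.inr, Sum.inr_injective⟩) := by
  rw [Finset.disjoint_left]
  intro w h1 h2
  simp only [Finset.mem_map, Function.Embedding.coeFn_mk] at h1 h2
  obtain ⟨i, -, rfl⟩ := h1
  obtain ⟨m, -, h⟩ := h2
  cases h

/-- `|Rel| = |Iidx| + |Ridx|`. -/
theorem card_Rel : (Rel gs m₀).card = (Iidx gs m₀).card + (Ridx gs m₀).card := by
  rw [Rel_eq, card_union_of_disjoint disjoint_IR, card_map, card_map]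

/-- gate-node total of the relevant gate roots -/
def Γg (gs : List (Gate (Fin N))) (m₀ : ℕ) : ℕ := ∑ m ∈ Ridx gs m₀, (UR (isRoot gs m₀) gs m).ngates

/-- variable total of the relevant gate roots -/
def nv (gs : List (Gate (Fin N))) (m₀ : ℕ) : ℕ := ∑ m ∈ Ridx gs m₀, (UR (isRoot gs m₀) gs m).vars.card

/-- Occurrences = relevant input roots + variables of the relevant gate roots' unfoldings. -/
theorem nocc_eq : nocc gs m₀ = (Iidx gs m₀).card + nv gs m₀ := by
  rw [nocc, Rel_eq, sum_union disjoint_IR, sum_map, sum_map]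
  simp [form, vars, nv]

/-- Relevant gate roots are root gates. -/
theorem Ridx_subset_rootIdx (hwf : WFL gs) (hm₀ : m₀ < gs.length) : Ridx gs m₀ ⊆ rootIdx gs m₀ :=
  fun _ hm => inr_mem_rootIdx hwf hm₀ (mem_Ridx.1 hm)

/-- The output gate is a relevant gate root. -/
theorem m₀_mem_Ridx (hm₀ : m₀ < gs.length) : m₀ ∈ Ridx gs m₀ := mem_Ridx.2 (out_mem_Rel hm₀)

/-- (c2) `Rel` is the output plus references of relevant gate roots. -/
theorem card_Rel_le (hwf : WFL gs) (hm₀ : m₀ < gs.length) :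
    (Rel gs m₀).card ≤ 1 + ∑ m ∈ Ridx gs m₀, (UR (isRoot gs m₀) gs m).nrefs := by
  classical
  have hsub : Rel gs m₀ ⊆ insert (Sum.inr m₀)
      ((Ridx gs m₀).biUnion fun m => (UR (isRoot gs m₀) gs m).refs) := by
    intro w hw
    by_cases hne : w = Sum.inr m₀
    · simp [hne]
    · obtain ⟨m, hm, hwm⟩ := exists_parent hwf hm₀ hw hne
      exact mem_insert_of_mem (mem_biUnion.2 ⟨m, mem_Ridx.2 hm, hwm⟩)
  calc (Rel gs m₀).card ≤ _ := card_le_card hsub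
    _ ≤ ((Ridx gs m₀).biUnion fun m => (UR (isRoot gs m₀) gs m).refs).card + 1 := card_insert_le _ _
    _ ≤ (∑ m ∈ Ridx gs m₀, (UR (isRoot gs m₀) gs m).refs.card) + 1 :=
        Nat.add_le_add_right card_biUnion_le _
    _ ≤ (∑ m ∈ Ridx gs m₀, (UR (isRoot gs m₀) gs m).nrefs) + 1 :=
        Nat.add_le_add_right (sum_le_sum fun m _ => card_refs_le_nrefs _) _
    _ = _ := add_comm _ _

/-- (c1)+(c2): occurrences are at most relevant gate nodes plus one. -/
theorem nocc_le_Γ (hwf : WFL gs) (hm₀ : m₀ < gs.length) : nocc gs m₀ ≤ Γg gs m₀ + 1 := by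
  have h1 := card_Rel_le hwf hm₀
  have h2 : ∑ m ∈ Ridx gs m₀, ((UR (isRoot gs m₀) gs m).vars.card + (UR (isRoot gs m₀) gs m).nrefs) ≤
      ∑ m ∈ Ridx gs m₀, ((UR (isRoot gs m₀) gs m).ngates + 1) :=
    sum_le_sum fun m _ => (Nat.add_le_add_right (card_vars_le_nlits _) _).trans (nlits_add_nrefs_le _)
  rw [sum_add_distrib, sum_add_distrib, sum_const, smul_eq_mul, mul_one] at h2
  rw [nocc_eq]
  have h3 := card_Rel (gs := gs) (m₀ := m₀)
  unfold Γg
  unfold nv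
  omega

/-- Every gate of index `< length` is a node of its own rooted unfolding. -/
theorem self_mem_nodes (R : Fin N ⊕ ℕ → Bool) : ∀ gs : List (Gate (Fin N)), (∀ g ∈ gs, g.arity ≤ 2) →
    ∀ m < gs.length, m ∈ (UR R gs m).nodes := by
  intro gs
  induction gs using List.reverseRecOn with
  | nil => intro _ m hm; simp at hm
  | append_singleton gs g ih =>
    intro har m hm
    have har' : ∀ g' ∈ gs, g'.arity ≤ 2 := fun g' hg' => har g' (by simp [hg'])
    rcases Nat.lt_or_ge m gs.length with hlt | hge
    · rw [UR_append_of_lt R g hlt]; exact ih har' m hlt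
    · have hm' : m = gs.length := by simp at hm; omega
      subst hm'
      rw [UR_append_self]
      have hg := har g (by simp)
      rcases g with ⟨_ | _ | _ | k, op, args⟩
      · simp [unfOfR, nodes]
      · simp [unfOfR, nodes]
      · simp [unfOfR, nodes]
      · simp at hg

/-- (c3)–(c5): fan-out lower bound from relevant gate roots and expanded gate nodes. -/
theorem refL_lower (hwf : WFL gs) (har : ∀ g ∈ gs, g.arity ≤ 2) (hm₀ : m₀ < gs.length) :
    2 * ((Ridx gs m₀).card - 1) + (Γg gs m₀ - (Ridx gs m₀).card) ≤ ∑ m ∈ range gs.length, refL gs m ∧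
      (Ridx gs m₀).card ≤ Γg gs m₀ := by
  classical
  set X := (Ridx gs m₀).biUnion fun m => (UR (isRoot gs m₀) gs m).nodes with hX
  have hRsub := Ridx_subset_rootIdx hwf hm₀
  have hXcard : X.card = Γg gs m₀ := by
    rw [hX, card_biUnion (fun m hm m' hm' hne =>
      disjoint_nodes_UR hwf har (hRsub hm) (hRsub hm') hne)]
    exact sum_congr rfl fun m hm => (ngates_UR hwf har (hRsub hm)).symm
  have hRX : Ridx gs m₀ ⊆ X := fun m hm =>
    mem_biUnion.2 ⟨m, hm, self_mem_nodes _ gs har m (lt_of_inr_mem_Rel (mem_Ridx.1 hm))⟩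
  have hRleΓ : (Ridx gs m₀).card ≤ Γg gs m₀ := hXcard ▸ card_le_card hRX
  refine ⟨?_, hRleΓ⟩
  set I := X \ Ridx gs m₀ with hI
  set Rno := (Ridx gs m₀).erase m₀ with hRno
  have hIprop : ∀ j ∈ I, j < gs.length ∧ 1 ≤ refL gs j := by
    intro j hj
    rw [hI, Finset.mem_sdiff] at hj
    obtain ⟨hjX, hjR⟩ := hj
    obtain ⟨m, hm, hjm⟩ := mem_biUnion.1 hjX
    obtain ⟨h1, h2⟩ := nodes_UR (isRoot gs m₀) gs hwf m j hjm
    rcases h2 with rfl | ⟨-, h3⟩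
    · exact absurd hm hjR
    · exact ⟨h1, h3⟩
  have hRnoprop : ∀ m ∈ Rno, m < gs.length ∧ 2 ≤ refL gs m := by
    intro m hm
    rw [hRno, mem_erase] at hm
    obtain ⟨hne, hm⟩ := hm
    have hr := isRoot_of_mem_Rel hwf hm₀ (mem_Ridx.1 hm)
    simp only [isRoot, decide_eq_true_eq] at hr
    exact ⟨lt_of_inr_mem_Rel (mem_Ridx.1 hm), by omega⟩
  have hdisj : Disjoint Rno I := by
    rw [Finset.disjoint_left]
    intro m hm hmI
    rw [hI, Finset.mem_sdiff] at hmI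
    exact hmI.2 (mem_of_mem_erase hm)
  have hsub : Rno ∪ I ⊆ range gs.length := by
    intro m hm
    rcases mem_union.1 hm with hm | hm
    · exact mem_range.2 (hRnoprop m hm).1
    · exact mem_range.2 (hIprop m hm).1
  have hIcard : Γg gs m₀ - (Ridx gs m₀).card ≤ I.card := by
    rw [← hXcard, hI]; exact le_card_sdiff _ _
  have hRnocard : Rno.card = (Ridx gs m₀).card - 1 := by
    rw [hRno, card_erase_of_mem (m₀_mem_Ridx hm₀)]
  calc 2 * ((Ridx gs m₀).card - 1) + (Γg gs m₀ - (Ridx gs m₀).card)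
      ≤ Rno.card * 2 + I.card * 1 := by rw [hRnocard]; omega
    _ ≤ ∑ m ∈ Rno, refL gs m + ∑ m ∈ I, refL gs m := by
        refine Nat.add_le_add ?_ ?_
        · have := card_nsmul_le_sum Rno (refL gs) 2 (fun m hm => (hRnoprop m hm).2)
          simpa using this
        · have := card_nsmul_le_sum I (refL gs) 1 (fun m hm => (hIprop m hm).2)
          simpa using this
    _ = ∑ m ∈ Rno ∪ I, refL gs m := (sum_union hdisj).symm
    _ ≤ ∑ m ∈ range gs.length, refL gs m :=
        sum_le_sum_of_subset_of_nonneg hsub (fun _ _ _ => Nat.zero_le _)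

/-- (c5, inputs): read lower bound from relevant input roots and root-formula variables. -/
theorem reads_lower (hwf : WFL gs) (har : ∀ g ∈ gs, g.arity ≤ 2) (hm₀ : m₀ < gs.length) :
    nv gs m₀ + 2 * (Iidx gs m₀).card ≤ ∑ i : Fin N, reads gs i := by
  classical
  set V := (Ridx gs m₀).biUnion fun m => (UR (isRoot gs m₀) gs m).vars with hV
  have hRsub := Ridx_subset_rootIdx hwf hm₀
  have hVcard : V.card = nv gs m₀ := by
    rw [hV, card_biUnion (fun m hm m' hm' hne =>
      disjoint_vars_UR hwf har (hRsub hm) (hRsub hm') hne)]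
    rfl
  have hVprop : ∀ i ∈ V, isRoot gs m₀ (.inl i) = false ∧ 1 ≤ reads gs i := by
    intro i hi
    obtain ⟨m, -, him⟩ := mem_biUnion.1 hi
    exact vars_UR (isRoot gs m₀) gs hwf m i him
  have hIprop : ∀ i ∈ Iidx gs m₀, 2 ≤ reads gs i := by
    intro i hi
    have := isRoot_of_mem_Rel hwf hm₀ (mem_Iidx.1 hi)
    simpa [isRoot] using this
  have hdisj : Disjoint V (Iidx gs m₀) := by
    rw [Finset.disjoint_left]
    intro i hiV hiI
    have h1 := (hVprop i hiV).1
    have h2 := isRoot_of_mem_Rel hwf hm₀ (mem_Iidx.1 hiI)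
    rw [h1] at h2
    exact Bool.false_ne_true h2
  calc nv gs m₀ + 2 * (Iidx gs m₀).card = V.card * 1 + (Iidx gs m₀).card * 2 := by rw [hVcard]; ring
    _ ≤ ∑ i ∈ V, reads gs i + ∑ i ∈ Iidx gs m₀, reads gs i := by
        refine Nat.add_le_add ?_ ?_
        · have := card_nsmul_le_sum V (reads gs) 1 (fun i hi => (hVprop i hi).2)
          simpa using this
        · have := card_nsmul_le_sum (Iidx gs m₀) (reads gs) 2 hIprop
          simpa using this
    _ = ∑ i ∈ V ∪ Iidx gs m₀, reads gs i := (sum_union hdisj).symm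
    _ ≤ ∑ i : Fin N, reads gs i :=
        sum_le_sum_of_subset_of_nonneg (subset_univ _) (fun _ _ _ => Nat.zero_le _)

/-- The arity of a gate is the number of its input slots plus the number of its gate slots. -/
theorem arity_eq (g : Gate (Fin N)) (L : ℕ) (hwf : ∀ (a : Fin g.arity) (m : ℕ), g.args a = .inr m → m < L) :
    g.arity = ∑ i : Fin N, cntI g i + ∑ m ∈ range L, cnt g m := by
  have h1 : ∀ i, cntI g i = ∑ a : Fin g.arity, (if g.args a = .inl i then 1 else 0) := fun i => by
    rw [cntI, card_eq_sum_ones, sum_filter]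
  have h2 : ∀ m, cnt g m = ∑ a : Fin g.arity, (if g.args a = .inr m then 1 else 0) := fun m => by
    rw [cnt, card_eq_sum_ones, sum_filter]
  simp_rw [h1, h2]
  rw [sum_comm, sum_comm (s := range L), ← sum_add_distrib]
  have h3 : ∀ a : Fin g.arity, (∑ i : Fin N, (if g.args a = .inl i then 1 else 0)) +
      (∑ m ∈ range L, (if g.args a = .inr m then 1 else 0)) = 1 := by
    intro a
    cases ha : g.args a with
    | inl i₀ =>
      simp only [Sum.inl.injEq, reduceCtorEq, if_false, sum_const_zero, add_zero]
      rw [sum_ite_eq]; simp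
    | inr m₁ =>
      have hm₁ := hwf a m₁ ha
      simp only [reduceCtorEq, if_false, sum_const_zero, zero_add, Sum.inr.injEq]
      rw [sum_ite_eq]; simp [hm₁]
  rw [sum_congr rfl (fun a _ => h3 a)]
  simp

/-- Total arity = total reads of inputs + total fan-out of gates. -/
theorem sum_arity_eq : ∀ gs : List (Gate (Fin N)), WFL gs →
    (gs.map Gate.arity).sum = ∑ i : Fin N, reads gs i + ∑ m ∈ range gs.length, refL gs m := by
  intro gs
  induction gs using List.reverseRecOn with
  | nil => intro _; simp [reads, refL]
  | append_singleton gs g ih =>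
    intro hwf
    have h1 := ih hwf.init
    have h2 := arity_eq g gs.length (fun a m ha => hwf.last a m ha)
    rw [List.map_append, List.sum_append, h1, List.map_singleton, List.sum_singleton, h2,
      List.length_append, List.length_singleton, sum_range_succ, refL_new_eq_zero hwf, add_zero]
    simp only [reads_append_singleton, refL_append_singleton, sum_add_distrib]
    ring

/-- A program of fan-in `≤ 2` has at most `2G` argument slots. [folklore] -/
theorem sum_arity_le (gs : List (Gate (Fin N))) (har : ∀ g ∈ gs, g.arity ≤ 2) :
    (gs.map Gate.arity).sum ≤ 2 * gs.length := by
  induction gs with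
  | nil => simp
  | cons g gs ih =>
    simp only [List.map_cons, List.sum_cons, List.length_cons]
    have := har g (by simp)
    have := ih (fun g' hg' => har g' (by simp [hg']))
    omega

/-- **THE COUNT.** -/
theorem count (hwf : WFL gs) (har : ∀ g ∈ gs, g.arity ≤ 2) (hm₀ : m₀ < gs.length) :
    (Rel gs m₀).card + 2 * nocc gs m₀ ≤ 2 * gs.length + 3 := by
  have hA := sum_arity_le gs har
  rw [sum_arity_eq gs hwf] at hA
  have hr := reads_lower hwf har hm₀
  obtain ⟨hf, hRΓ⟩ := refL_lower hwf har hm₀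
  have hn := nocc_le_Γ hwf hm₀
  rw [nocc_eq] at hn ⊢
  rw [card_Rel]
  have h1 : 1 ≤ (Ridx gs m₀).card := card_pos.2 ⟨m₀, m₀_mem_Ridx hm₀⟩
  omega

/-- Occurrences are distinct input variables. -/
theorem nocc_le_N (hwf : WFL gs) (har : ∀ g ∈ gs, g.arity ≤ 2) (hm₀ : m₀ < gs.length) :
    nocc gs m₀ ≤ N := by
  classical
  rw [nocc, ← card_biUnion (fun w hw w' hw' hne => disjoint_form_vars hwf har hm₀ hw hw' hne)]
  exact (card_le_univ _).trans (by simp)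

end Fixed

end BF

end Count

end Summit.PneNP.PneNP.Theorems.GapMCSPWindowCellZero
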